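import Summits.ABC.IUTFork.Cor312ReadingIso
import Summits.ABC.IUTFork.Cor312StepContents
import Summits.ABC.IUTFork.Cor312StepXIfChain
import HarnessLib

/-!
# [IUTchIII] Cor. 3.12 — TEAM A master composition: the printed proof, end to end, modulo its named inputs

Record-only file (D-0012) of the abc-iut cell (Cor. 3.12 STRATEGY TEAM A «direct III§3», D-0067, seat
abc-iut-c312-9 = A1, row A-4 of `HOME/plan/C312-TEAMS.md`); TAKES NO SIDE; proof-only. With the chain
scaffold landed (`Cor312StepContents.cor312_of_contents_and_gap`: the twenty printed nodes modulo the one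
(xi-f) inference) and the reading ladder landed (`Cor312ReadingIso`: READING 0 `statement_of_qLocal_le` is
the weakest volume interface), the team's MASTER THEOREM composes end to end:

* `teamA_statement_modulo` — **the whole printed proof of Cor. 3.12 (kurims `paper:url-4b091feeb646`
  pp. 174–186), as one kernel theorem over the verbatim setting**, with every input NAMED: the bridge
  hypotheses `H` (log-volume monotone, possible images admissible, hulls nonempty, `ThetaFinite`, per
  `BridgeHyps`), the positivity `hq` ("`|log(q)| > 0`"), every locus granted (`hL` — the frozen definitions
  and the FACT-LIST), the content implications of the nineteen undisputed nodes (`hcontents` — Team A rows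
  A-1/A-2/A-3/A-5 discharge these from the landed readings), the (xi-f) inference in its solved form
  (`hgap` — `Cor312StepXIfChain.xi_f_holds_iff`), and the HONEST volume reading of (xi-f)'s conclusion
  (`hread`: "constitutes … a construction … of `−|log(q)|`" read at volume level = READING 0). Conclusion:
  the printed `Statement`.
* `teamA_statement_of_readings` — the instantiation collapsing the chain: granting a reading `O` that makes
  `constitutesConstruction` the READING-0 statement and grants the rest, the Statement follows from
  `hgap` alone — the chain contributes bookkeeping, the content is `hgap` (consistent with the landed
  `realEdges_iff_cor312` and the isolation `Cor312TeamAGapWitness.thm311_bridgeHyps_not_imp_statement`).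

The remaining OPEN inputs for the 13:00Z adjudication are exactly: discharge `hcontents` from the landed
honest readings (A-1 `Cor312StepXReal`, A-3 `Cor312StepXIdeReal`, A-2/A-5 in flight) and decide `hgap`/
`hread`'s antecedent for the ASSEMBLED real setting (the gap witness shows the frozen interfaces alone do
not yield it). QUANTIFIER CAUTION (skel FORK FINDING, INBOX 23:23:08Z; concurred by c312-1): `hread`'s
READING-0 form — like every per-packet reading in the catalogue (R2/R3/R4/VolumeTransport) — is SUFFICIENT
but STRICTLY STRONGER than the printed conclusion, which compares only the two GLOBAL procession-normalized
numbers ((xi-d) p. 183, Step (xii) p. 185 l. 59 – p. 186 l. 3 prints why nothing local is meant); in the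
intended model a deep bad place can break the per-packet forms while the global Statement survives. So this
composition documents the SUFFICIENT route; the faithful GLOBAL gap statement (the Step (xi) soundness of
the multiradial algorithm at the link-identified input strip, skel XXIV `ForkLocalGlobal`) is what the
GAP-LEDGER row will carry — not READING 0. [claim: Mochizuki2012, status: disputed]
Deliberately NOT here: the honest readings themselves (teammates' files); any claim that `hgap` holds for an
instantiated setting; any judgement on (xi-f).
-/

namespace Summit.ABC

namespace IUTFork

namespace Cor312Vol

open Thm311 Cor312 Cor312Proof Literature.IUT.LogThetaLattice

variable {T : ThetaIndex} {S : Situation T} {P : Cor312.Setting S}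

/-- **TEAM A MASTER THEOREM — the printed proof of Cor. 3.12, end to end, modulo its named inputs.**
Granting the bridge hypotheses, `|log(q)| > 0`, every locus, the content implications of the nineteen
undisputed nodes, the (xi-f) implication, and the honest volume reading of (xi-f)'s conclusion, the printed
`Statement` follows — `cor312_of_contents_and_gap` through the verbatim volumes (`verbatimVolumes_cor312_iff`)
with the (xi-f)→inequality edge supplied by READING 0 (`statement_of_qLocal_le`).
[claim: Mochizuki2012, status: disputed] -/
theorem teamA_statement_modulo (H : BridgeHyps P) (hq : P.AbsLogQPos)
    {L : Locus → Prop} {O : Obs → Prop} (hL : ∀ c, L c)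
    (hcontents : ∀ s : Step, s ≠ Step.xi_f → (∀ o ∈ s.uses, O o) → ∀ o ∈ s.concl, O o)
    (hgap : O .displayXIe → O .sheMeansFixedValue → O .constitutesConstruction)
    (hread : O .constitutesConstruction →
      ∀ (i : Fin T.lstar) (vQ : T.VQ),
        P.qLocal (Setting.labelSucc i) vQ ≤ (P.thetaLocal (Setting.labelSucc i) vQ).untopD 0) :
    P.Statement :=
  (verbatimVolumes_cor312_iff H hq).1
    (cor312_of_contents_and_gap hL hcontents hgap
      ((realEdges_verbatim_iff H hq O).2 fun hc => statement_of_qLocal_le H (hread hc)))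

/-- The collapse: under the canonical gap reading — `constitutesConstruction` IS the READING-0 statement,
every other observation granted — the master theorem needs only `hgap`: the chain is bookkeeping, the
content is the one implication (consistent with the landed `realEdges_iff_cor312` and the gap witness).
[claim: Mochizuki2012, status: disputed] -/
theorem teamA_statement_of_readings (H : BridgeHyps P) (hq : P.AbsLogQPos)
    (hgap : ∀ (i : Fin T.lstar) (vQ : T.VQ),
      P.qLocal (Setting.labelSucc i) vQ ≤ (P.thetaLocal (Setting.labelSucc i) vQ).untopD 0) :
    P.Statement :=
  teamA_statement_modulo H hq (L := fun _ => True) (O := fun o =>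
      if o = Obs.constitutesConstruction then
        ∀ (i : Fin T.lstar) (vQ : T.VQ),
          P.qLocal (Setting.labelSucc i) vQ ≤ (P.thetaLocal (Setting.labelSucc i) vQ).untopD 0
      else True)
    (fun _ => trivial)
    (fun s _ _ o _ => by
      by_cases ho : o = Obs.constitutesConstruction
      · subst ho; exact hgap
      · simp only [if_neg ho])
    (fun _ _ => hgap)
    (fun hc => hc)

end Cor312Vol

end IUTFork

end Summit.ABC
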